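import Summits.Ventures.Crystal3D.Theorems.StickyWulffConstantGenericWallFloorDoubleStarOfFar
import Summits.Ventures.Crystal3D.Theorems.StickyWulffConstantGenericWallFloorMultiStarCount
import Summits.Ventures.Crystal3D.Theorems.StickyWulffConstantGenericWallFloorCoaxialIff
import Summits.Ventures.Crystal3D.Theorems.StickyWulffConstantCoaxialWallLawKFoldTop
import HarnessLib

/-!
# The k-fold-top census for FULL-SHELL predecessors is `DoubleTopFar` (certified): all `k`, by pairwise covering

HONEST FRAMING. Part of the venture `Summits/Ventures/Crystal3D` (cell `crystal3d-full`), helper for the crux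
`CoaxialWallLaw` (stmt-Ventures-19481) of `route-Ventures-StickyWulffConstant`, REGISTERED line `WallLedgerF`
(planner cf-p1 gen 16), open stub `stub_coaxialTwoSlabAdhesion` (general fillings).  Rung credit only; F-C1 not
moved.  The census target `KFoldTopDeficit` (`…KFoldTop`, posited; the one local input of the SHARP twin law
`coaxialTwoSlabAdhesion_general_twin_of_census`, `…SharpTwin`) asks: `k ≥ 2` exact arrival clusters through one
ball `b`, distinct centres, pairwise non-co-axial frames ⇒ `deg b + k ≤ 12`.  THIS FILE PROVES IT FOR EVERY `k`
WHEN ALL PREDECESSORS HAVE FULL SHELLS (fcc 13-clusters), from the certified computation `DoubleTopFar` (19480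
lane, wulff-p2 g9; certified twice, R39d / R41e) ALONE: by `doubleStarCoaxialAt_of_far` any two non-co-axial full
stars at `b` COVER the contacts of `b`, and 19480-p2's finite combinatorics `card_contacts_add_card_le_twelve`
(`…MultiStarCount`: `k` distinct pairwise-covering `5`-subsets of an `≤ 11`-set `N` force `|N| + k ≤ 12`) does the
rest.  So the census rows that remain for `KFoldTopDeficit` are exactly the PAIRWISE ones with a twin-reading
(hcp 13-cluster) predecessor — no triple-top row is needed beyond pairwise covering.

* `slots_eq_or_mirror_of_coaxial` — bridge: linear Barlow co-axiality (the conclusion of `DoubleStarCoaxialAt`)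
  ⇒ the slot dozens are equal or mirror images across a unit menu normal (extracted from 19480-p2's
  `not_coaxial_of_two_states`, `…StackWalkStarExclusion`).
* **`kFoldTop_full_of_doubleTopFar`** — `DoubleTopFar` ⇒ the all-full-shell case of `KFoldTopDeficit`, every `k`.

WHAT THIS IS NOT: not `KFoldTopDeficit` itself (pairs with a twin-reading predecessor are not covered); not the
stub; F-C1 not moved.
-/

noncomputable section

namespace Summit.Ventures.Crystal3D.Theorems

open Summit.Ventures.Crystal3D Finset
open Literature.MathematicalPhysics.StatisticalMechanics (fccStacking barlowStacking IsHaggSeq)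
open scoped InnerProductSpace

variable {X : Finset (EuclideanSpace ℝ (Fin 3))}

/-- **Bridge: Barlow co-axiality of two linear lattices ⇒ equal or mirrored slot dozens.** -/
theorem slots_eq_or_mirror_of_coaxial (A₁ A₂ : EuclideanSpace ℝ (Fin 3) ≃ₗᵢ[ℝ] EuclideanSpace ℝ (Fin 3))
    (hco : ∃ (L : EuclideanSpace ℝ (Fin 3) ≃ₗᵢ[ℝ] EuclideanSpace ℝ (Fin 3))
      (s₁ s₂ : EuclideanSpace ℝ (Fin 3)) (σ σ' : ℤ → ℤ), IsHaggSeq σ ∧ IsHaggSeq σ' ∧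
      A₁ '' fccStacking 1 (Real.sqrt (2 / 3)) ⊆ (fun p => L p + s₁) '' barlowStacking 1 (Real.sqrt (2 / 3)) σ ∧
      A₂ '' fccStacking 1 (Real.sqrt (2 / 3)) ⊆ (fun p => L p + s₂) '' barlowStacking 1 (Real.sqrt (2 / 3)) σ') :
    (A₂ : EuclideanSpace ℝ (Fin 3) → EuclideanSpace ℝ (Fin 3)) '' ↑fccSlots =
        (A₁ : EuclideanSpace ℝ (Fin 3) → EuclideanSpace ℝ (Fin 3)) '' ↑fccSlots ∨
      ∃ n : EuclideanSpace ℝ (Fin 3), ‖n‖ = 1 ∧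
        (∀ w ∈ fccSlots, ⟪A₁ w, n⟫_ℝ = 0 ∨ ⟪A₁ w, n⟫_ℝ = Real.sqrt (2 / 3) ∨ ⟪A₁ w, n⟫_ℝ = -Real.sqrt (2 / 3)) ∧
        (A₂ : EuclideanSpace ℝ (Fin 3) → EuclideanSpace ℝ (Fin 3)) '' ↑fccSlots =
          (fun x => A₁ x - (2 * ⟪A₁ x, n⟫_ℝ) • n) '' ↑fccSlots := by
  have haff := coaxial_affine_of_linear A₁ A₂ 0 0 hco
  by_cases hEq : A₁ '' fccStacking 1 (Real.sqrt (2 / 3)) = A₂ '' fccStacking 1 (Real.sqrt (2 / 3))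
  · exact Or.inl (image_fccSlots_eq_of_image_fcc_eq _ _ hEq.symm)
  right
  obtain ⟨L, hL⟩ := twin_of_coaxial_of_ne A₁ A₂ 0 0 haff hEq
  set e₃ : EuclideanSpace ℝ (Fin 3) := EuclideanSpace.single (2 : Fin 3) (1 : ℝ) with he₃
  have he₃n : ‖e₃‖ = 1 := by rw [he₃, PiLp.norm_single, norm_one]
  have hm : ‖L e₃‖ = 1 := by rw [LinearIsometryEquiv.norm_map, he₃n]
  have hinv : ∀ S : Set (EuclideanSpace ℝ (Fin 3)),
      (fun x => x - (2 * ⟪x, L e₃⟫_ℝ) • L e₃) '' ((fun x => x - (2 * ⟪x, L e₃⟫_ℝ) • L e₃) '' S) = S := by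
    intro S
    rw [Set.image_image]
    conv_rhs => rw [← Set.image_id S]
    exact Set.image_congr fun x _ => reflect_reflect_unit hm x
  have key : A₂ '' fccStacking 1 (Real.sqrt (2 / 3)) =
      (fun x => x - (2 * ⟪x, L e₃⟫_ℝ) • L e₃) '' (A₁ '' fccStacking 1 (Real.sqrt (2 / 3))) ∧
      (A₁ '' fccStacking 1 (Real.sqrt (2 / 3)) = L '' fccStacking 1 (Real.sqrt (2 / 3)) ∨
      A₁ '' fccStacking 1 (Real.sqrt (2 / 3)) = L '' barlowStacking 1 (Real.sqrt (2 / 3)) (fun _ : ℤ => (-1 : ℤ))) := by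
    rcases hL with ⟨h₁, h₂⟩ | ⟨h₁, h₂⟩
    · exact ⟨by rw [h₂, image_negConst_eq_reflection_image, ← h₁], Or.inl h₁⟩
    · refine ⟨?_, Or.inr h₁⟩
      rw [h₁, image_negConst_eq_reflection_image, hinv, h₂]
  obtain ⟨hrel, hcase⟩ := key
  have hmenu : ∀ w ∈ fccSlots, ⟪A₁ w, L e₃⟫_ℝ = 0 ∨ ⟪A₁ w, L e₃⟫_ℝ = Real.sqrt (2 / 3) ∨
      ⟪A₁ w, L e₃⟫_ℝ = -Real.sqrt (2 / 3) := by
    have hLmenu : ∀ w ∈ fccSlots, ⟪L w, L e₃⟫_ℝ = 0 ∨ ⟪L w, L e₃⟫_ℝ = Real.sqrt (2 / 3) ∨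
        ⟪L w, L e₃⟫_ℝ = -Real.sqrt (2 / 3) := by
      intro w hw
      rw [LinearIsometryEquiv.inner_map_map, he₃, EuclideanSpace.inner_single_right]
      simpa using slot_apply_two_cases hw
    rcases hcase with h₁ | h₁
    · exact menu_of_image_eq L A₁ h₁.symm hLmenu
    · rw [image_negConst_eq_reflection_image] at h₁
      intro w hw
      have hmem : A₁ w ∈ (fun x => x - (2 * ⟪x, L e₃⟫_ℝ) • L e₃) '' (L '' fccStacking 1 (Real.sqrt (2 / 3))) := by
        rw [← h₁]; exact ⟨w, mem_fcc_of_mem_fccSlots hw, rfl⟩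
      obtain ⟨x', hx', he⟩ := hmem
      obtain ⟨q, hq, hqx⟩ := hx'
      rw [← hqx] at he
      dsimp only at he
      have hq1 : ‖q‖ = 1 := by
        have := congrArg norm he
        rw [LinearIsometryEquiv.norm_map, norm_eq_one_of_mem_fccSlots hw] at this
        rw [← this, ← reflection_unit_apply hm, LinearIsometryEquiv.norm_map, LinearIsometryEquiv.norm_map]
      rw [← he, ← reflection_unit_apply hm, inner_reflection_unit hm]
      rcases hLmenu q (mem_fccSlots_of_unit hq hq1) with h | h | h
      · left; rw [h, neg_zero]
      · right; right; rw [h]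
      · right; left; rw [h, neg_neg]
  refine ⟨L e₃, hm, hmenu, ?_⟩
  have himg : (A₂ : EuclideanSpace ℝ (Fin 3) → EuclideanSpace ℝ (Fin 3)) '' ↑fccSlots =
      (twinFrame A₁ (L e₃) : EuclideanSpace ℝ (Fin 3) → EuclideanSpace ℝ (Fin 3)) '' ↑fccSlots := by
    apply image_fccSlots_eq_of_image_fcc_eq
    rw [hrel, Set.image_image]
    exact Set.image_congr fun x _ => (twinFrame_apply A₁ hm x).symm
  rw [himg]
  exact Set.image_congr fun x _ => twinFrame_apply A₁ hm x

open scoped Classical in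
/-- **`DoubleTopFar` ⇒ the all-full-shell case of `KFoldTopDeficit`, for every `k`.**  See the module docstring. -/
theorem kFoldTop_full_of_doubleTopFar (hfar : DoubleTopFar)
    (X : Finset (EuclideanSpace ℝ (Fin 3))) (hX : ∀ p ∈ X, ∀ q ∈ X, p ≠ q → 1 ≤ dist p q)
    (b : EuclideanSpace ℝ (Fin 3)) (hb : b ∈ X)
    (S : Finset ((EuclideanSpace ℝ (Fin 3) ≃ₗᵢ[ℝ] EuclideanSpace ℝ (Fin 3)) × EuclideanSpace ℝ (Fin 3)))
    (h2 : 2 ≤ S.card)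
    (hS : ∀ s ∈ S, s.2 ∈ fccSlots ∧ b - s.1 s.2 ∈ X)
    (hfull : ∀ s ∈ S, ∀ w ∈ fccSlots, b - s.1 s.2 + s.1 w ∈ X)
    (hnc : ∀ s ∈ S, ∀ t ∈ S, s ≠ t →
      (t.1 : EuclideanSpace ℝ (Fin 3) → EuclideanSpace ℝ (Fin 3)) '' ↑fccSlots ≠
        (s.1 : EuclideanSpace ℝ (Fin 3) → EuclideanSpace ℝ (Fin 3)) '' ↑fccSlots ∧
      ∀ n : EuclideanSpace ℝ (Fin 3), ‖n‖ = 1 →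
        (∀ w ∈ fccSlots, ⟪s.1 w, n⟫_ℝ = 0 ∨ ⟪s.1 w, n⟫_ℝ = Real.sqrt (2 / 3) ∨ ⟪s.1 w, n⟫_ℝ = -Real.sqrt (2 / 3)) →
        (t.1 : EuclideanSpace ℝ (Fin 3) → EuclideanSpace ℝ (Fin 3)) '' ↑fccSlots ≠
          (fun x => s.1 x - (2 * ⟪s.1 x, n⟫_ℝ) • n) '' ↑fccSlots) :
    (X.filter fun q => dist b q = 1).card + S.card ≤ 12 := by
  -- non-co-axiality in the Barlow sense
  have hncB : ∀ s ∈ S, ∀ t ∈ S, s ≠ t →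
      ¬ ∃ (L : EuclideanSpace ℝ (Fin 3) ≃ₗᵢ[ℝ] EuclideanSpace ℝ (Fin 3))
        (s₁ s₂ : EuclideanSpace ℝ (Fin 3)) (σ σ' : ℤ → ℤ), IsHaggSeq σ ∧ IsHaggSeq σ' ∧
        s.1 '' fccStacking 1 (Real.sqrt (2 / 3)) ⊆ (fun p => L p + s₁) '' barlowStacking 1 (Real.sqrt (2 / 3)) σ ∧
        t.1 '' fccStacking 1 (Real.sqrt (2 / 3)) ⊆ (fun p => L p + s₂) '' barlowStacking 1 (Real.sqrt (2 / 3)) σ' := by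
    intro s hs t ht hst hco
    obtain ⟨h1, h2⟩ := hnc s hs t ht hst
    rcases slots_eq_or_mirror_of_coaxial s.1 t.1 hco with h | ⟨n, hn, hmenu, h⟩
    · exact h1 h
    · exact h2 n hn hmenu h
  -- owned stars: `b + A w ∈ X` for `⟪w, u⟫ < 0`
  have hown : ∀ s ∈ S, ∀ w ∈ fccSlots, ⟪w, s.2⟫_ℝ < 0 → b + s.1 w ∈ X := by
    intro s hs w hw hneg
    obtain ⟨hu, hp⟩ := hS s hs
    rcases inner_slots_mem hw hu with h | h | h | h | h
    · rw [h] at hneg; norm_num at hneg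
    · rw [h] at hneg; norm_num at hneg
    · rw [h] at hneg; exact absurd hneg (lt_irrefl 0)
    · have ht : s.2 + w ∈ fccSlots := add_mem_fccSlots_of_inner_eq_neg_half hu hw (by rw [real_inner_comm]; exact h)
      have := hfull s hs _ ht
      have e : b - s.1 s.2 + s.1 (s.2 + w) = b + s.1 w := by rw [map_add]; abel
      rw [e] at this
      exact this
    · have hw' : w = -s.2 := eq_neg_of_inner_eq_neg_one hu hw (by rw [real_inner_comm]; exact h)
      rw [hw', map_neg, ← sub_eq_add_neg]; exact hp
  -- two members: the contacts are covered, hence `deg ≤ 10`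
  have hcov : ∀ s ∈ S, ∀ t ∈ S, s ≠ t →
      ∀ q ∈ X, dist b q = 1 → q ∈ starSet b s.1 s.2 ∪ starSet b t.1 t.2 := by
    intro s hs t ht hst q hqX hqd
    by_contra hq
    rw [Finset.mem_union, not_or] at hq
    obtain ⟨hu₁, hp₁⟩ := hS s hs
    obtain ⟨hu₂, hp₂⟩ := hS t ht
    have off : ∀ (A : EuclideanSpace ℝ (Fin 3) ≃ₗᵢ[ℝ] EuclideanSpace ℝ (Fin 3)) (u : EuclideanSpace ℝ (Fin 3)),
        q ∉ starSet b A u → ∀ w ∈ fccSlots, ⟪w, u⟫_ℝ < 0 → q ≠ b + A w := by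
      intro A u hq' w hw hwu hqw
      apply hq'
      unfold starSet
      exact Finset.mem_image.2 ⟨w, mem_filter.2 ⟨hw, hwu⟩, hqw.symm⟩
    have hlin := doubleStarCoaxialAt_of_far hfar s.1 t.1 s.2 hu₁ t.2 hu₂ X hX b hb hp₁ (hfull s hs) hp₂ (hfull t ht)
      q hqX hqd (off s.1 s.2 hq.1) (off t.1 t.2 hq.2)
    exact hncB s hs t ht hst hlin
  have hdiff : ∀ s ∈ S, ∀ t ∈ S, s ≠ t → starSet b s.1 s.2 ≠ starSet b t.1 t.2 := by
    intro s hs t ht hst hEq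
    exact hncB s hs t ht hst (coaxial_of_starSet_eq (hS s hs).1 hEq)
  -- `deg b ≤ 11` (indeed `≤ 10`) from one covering pair
  have hdeg : (X.filter fun q => dist b q = 1).card ≤ 11 := by
    obtain ⟨s, hs, t, ht, hst⟩ := Finset.one_lt_card.1 (by omega : 1 < S.card)
    have hsub : (X.filter fun q => dist b q = 1) ⊆ starSet b s.1 s.2 ∪ starSet b t.1 t.2 := by
      intro q hq
      obtain ⟨hqX, hqd⟩ := mem_filter.1 hq
      exact hcov s hs t ht hst q hqX hqd
    have := (card_le_card hsub).trans (card_union_le _ _)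
    rw [card_starSet b s.1 (hS s hs).1, card_starSet b t.1 (hS t ht).1] at this
    omega
  exact card_contacts_add_card_le_twelve hdeg S (fun s hs => (hS s hs).1) hown hdiff hcov

end Summit.Ventures.Crystal3D.Theorems

end
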